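import Summits.CriticalPhenomena.PercolationContinuityZ3.Theorems.PercShatteringRaceRaceLemma
import Summits.CriticalPhenomena.PercolationContinuityZ3.Theses.PercNonProliferation
import Literature.Probability.Percolation.ConnectivityThetaSqProofs
import HarnessLib

/-!
# Crux `PercShatteringRace.NearLinearTwoClusterDecay` (stmt-CriticalPhenomena-5785), line `critical-orange-peeling` — stub `percolationContinuityZ3_of_pairQuasiLocality_of_freeBoxSparse`

Helper file of the lead (seat c3, "consumed forms" programme D) of the line
`critical-orange-peeling`; proves exactly the registered stub signature
`percolationContinuityZ3_of_pairQuasiLocality_of_freeBoxSparse` and lands with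
`--supports stmt-CriticalPhenomena-5785`.

**What.** Bond percolation on `ℤ³` at `p_c`, measure
`P = bondPercolation (zdGraph 3) (criticalProbI 3)`, boxes `Λ_n = box 3 n`.  PAIR quasi-locality
`QL_M` (the planners' proposed replacement of the open crux `U`): for some `M ≥ 1`, `c > 0` and
all `n`, all `x, y ∈ Λ_n`, `P(x ↔ y inside Λ_{M n}) ≥ c · P(x ↔ y)`.  Together with the
neighbouring route's crux `PercNonProliferation.FreeBoxSparse` (stmt-CriticalPhenomena-4445: the
pair-averaged free-box connectivity `|Λ_n|⁻² Σ_{x,y ∈ Λ_n} P(x ↔ y inside Λ_n) → 0`) it forces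
`θ(p_c) = 0`, i.e. `PercolationContinuityZ3`.

**Why.** It certifies, on proved grounds only, that the deciding theorem of route
`PercShatteringRace` can consume the linear-scale pair form of quasi-locality instead of
two-cluster decay at aspect `n^{7/6}`.

**Proof.** Suppose `θ := θ(p_c) > 0`.  By uniqueness + Harris–FKG (PROVED in tree,
`Grimmett1999_theta_sq_le_openConn_holds`) `P(x ↔ y) ≥ θ²` for all `x, y`, so `QL_M` gives
`P(x ↔ y in Λ_{Mn}) ≥ c θ²` for `x, y ∈ Λ_n`.  Dropping the nonnegative terms outside
`Λ_n × Λ_n` (`Λ_n ⊆ Λ_{Mn}` as `M ≥ 1`), `Σ_{x,y ∈ Λ_{Mn}} P(x ↔ y in Λ_{Mn}) ≥ c θ² |Λ_n|²`,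
while `|Λ_{Mn}|² = (2Mn+1)⁶ ≤ (2M)⁶ |Λ_n|²`; hence the `FreeBoxSparse` quantity at index `M n`
is `≥ ε := c θ² / (2M)⁶ > 0` for EVERY `n`.  But along the subsequence `n ↦ M n → ∞` it tends
to `0`, so it is eventually `< ε`: contradiction.  (Same bookkeeping as
`FreeBoxPowerSavingNegative.fa2_mul_ge_of_boxLRO`, here against the qualitative `FreeBoxSparse`.)

Tree inputs: `Grimmett1999_theta_sq_le_openConn_holds` (`ConnectivityThetaSqProofs.lean`),
`card_box`, `box_mono`, `box_nonempty` (`ThermodynamicLimit.lean`).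
No new definitions, no named unproved facts.
-/

noncomputable section

namespace Summit.CriticalPhenomena.PercolationContinuityZ3.Theorems.NearLinearTwoClusterDecay.Consumed

open MeasureTheory Filter Topology
open Literature.Probability.LatticeModels Literature.Probability.Percolation

/-- `Λ_n ⊆ Λ_{M n}` for `M ≥ 1`. [folklore] -/
theorem box_subset_box_mul {M : ℕ} (hM : 1 ≤ M) (n : ℕ) : box 3 n ⊆ box 3 (M * n) :=
  box_mono 3 (Nat.le_mul_of_pos_left n hM)

/-- `|Λ_{M n}| ≤ (2M)³ |Λ_n|` for `M ≥ 1` (as reals): `2Mn + 1 ≤ 2M(2n+1)`. [folklore] -/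
theorem card_box_mul_le_two_mul_pow {M : ℕ} (hM : 1 ≤ M) (n : ℕ) :
    ((box 3 (M * n)).card : ℝ) ≤ (2 * (M : ℝ)) ^ 3 * ((box 3 n).card : ℝ) := by
  -- adapted from `FreeBoxPowerSavingNegative.card_box_mul_le` (tree), constant `(2M)³`
  rw [card_box, card_box]
  push_cast
  have hM1 : (1 : ℝ) ≤ M := by exact_mod_cast hM
  have hMn : (0 : ℝ) ≤ (M : ℝ) * n := by positivity
  have h : 2 * ((M : ℝ) * n) + 1 ≤ 2 * (M : ℝ) * (2 * (n : ℝ) + 1) := by nlinarith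
  calc (2 * ((M : ℝ) * n) + 1) ^ 3 ≤ (2 * (M : ℝ) * (2 * (n : ℝ) + 1)) ^ 3 :=
        pow_le_pow_left₀ (by positivity) h 3
    _ = (2 * (M : ℝ)) ^ 3 * (2 * (n : ℝ) + 1) ^ 3 := by ring

/-- **Pair box long-range order bounds the `FreeBoxSparse` quantity below.** If
`P(x ↔ y in Λ_{Mn}) ≥ ρ` for all `x, y ∈ Λ_n` (`M ≥ 1`, `ρ ≥ 0`), then
`|Λ_{Mn}|⁻² Σ_{x,y ∈ Λ_{Mn}} P(x ↔ y in Λ_{Mn}) ≥ ρ / (2M)⁶`: drop the nonnegative terms outside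
`Λ_n × Λ_n` and use `|Λ_{Mn}|² ≤ (2M)⁶ |Λ_n|²`. [folklore] -/
theorem div_le_pairAverage_of_boxLRO {M : ℕ} (hM : 1 ≤ M) {ρ : ℝ} (hρ : 0 ≤ ρ) {n : ℕ}
    (h : ∀ x ∈ box 3 n, ∀ y ∈ box 3 n,
      ρ ≤ (bondPercolation (zdGraph 3) (criticalProbI 3)).real
        (openConnIn (↑(box 3 (M * n)) : Set (Site 3)) x y)) :
    ρ / (2 * (M : ℝ)) ^ 6 ≤
      (∑ x ∈ box 3 (M * n), ∑ y ∈ box 3 (M * n),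
          (bondPercolation (zdGraph 3) (criticalProbI 3)).real
            (openConnIn (↑(box 3 (M * n)) : Set (Site 3)) x y)) /
        ((box 3 (M * n)).card : ℝ) ^ 2 := by
  -- adapted from `FreeBoxPowerSavingNegative.fa2_mul_ge_of_boxLRO` (tree)
  set μ := bondPercolation (zdGraph 3) (criticalProbI 3) with hμ
  have hsub : box 3 n ⊆ box 3 (M * n) := box_subset_box_mul hM n
  have hM0 : (0 : ℝ) < 2 * (M : ℝ) := by
    have hM1 : (1 : ℝ) ≤ M := by exact_mod_cast hM
    linarith
  have hcpos : (0 : ℝ) < ((box 3 (M * n)).card : ℝ) := by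
    exact_mod_cast Finset.card_pos.2 (box_nonempty 3 (M * n))
  -- `ρ |Λ_n|² ≤ Σ_{x,y ∈ Λ_{Mn}} P(x ↔ y in Λ_{Mn})`
  have hps : ρ * ((box 3 n).card : ℝ) ^ 2 ≤
      ∑ x ∈ box 3 (M * n), ∑ y ∈ box 3 (M * n),
        μ.real (openConnIn (↑(box 3 (M * n)) : Set (Site 3)) x y) := by
    calc ρ * ((box 3 n).card : ℝ) ^ 2 = ∑ _x ∈ box 3 n, ∑ _y ∈ box 3 n, ρ := by
          rw [Finset.sum_const, Finset.sum_const, nsmul_eq_mul, nsmul_eq_mul]; ring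
      _ ≤ ∑ x ∈ box 3 n, ∑ y ∈ box 3 n,
            μ.real (openConnIn (↑(box 3 (M * n)) : Set (Site 3)) x y) :=
          Finset.sum_le_sum fun x hx => Finset.sum_le_sum fun y hy => h x hx y hy
      _ ≤ ∑ x ∈ box 3 n, ∑ y ∈ box 3 (M * n),
            μ.real (openConnIn (↑(box 3 (M * n)) : Set (Site 3)) x y) :=
          Finset.sum_le_sum fun x _ =>
            Finset.sum_le_sum_of_subset_of_nonneg hsub fun _ _ _ => measureReal_nonneg
      _ ≤ ∑ x ∈ box 3 (M * n), ∑ y ∈ box 3 (M * n),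
            μ.real (openConnIn (↑(box 3 (M * n)) : Set (Site 3)) x y) :=
          Finset.sum_le_sum_of_subset_of_nonneg hsub fun _ _ _ =>
            Finset.sum_nonneg fun _ _ => measureReal_nonneg
  -- `|Λ_{Mn}|² ≤ (2M)⁶ |Λ_n|²`
  have hcard : ((box 3 (M * n)).card : ℝ) ^ 2 ≤
      (2 * (M : ℝ)) ^ 6 * ((box 3 n).card : ℝ) ^ 2 := by
    calc ((box 3 (M * n)).card : ℝ) ^ 2
        ≤ ((2 * (M : ℝ)) ^ 3 * ((box 3 n).card : ℝ)) ^ 2 :=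
          pow_le_pow_left₀ hcpos.le (card_box_mul_le_two_mul_pow hM n) 2
      _ = (2 * (M : ℝ)) ^ 6 * ((box 3 n).card : ℝ) ^ 2 := by ring
  rw [div_le_div_iff₀ (pow_pos hM0 6) (pow_pos hcpos 2)]
  calc ρ * ((box 3 (M * n)).card : ℝ) ^ 2
      ≤ ρ * ((2 * (M : ℝ)) ^ 6 * ((box 3 n).card : ℝ) ^ 2) := mul_le_mul_of_nonneg_left hcard hρ
    _ = ρ * ((box 3 n).card : ℝ) ^ 2 * (2 * (M : ℝ)) ^ 6 := by ring
    _ ≤ (∑ x ∈ box 3 (M * n), ∑ y ∈ box 3 (M * n),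
          μ.real (openConnIn (↑(box 3 (M * n)) : Set (Site 3)) x y)) * (2 * (M : ℝ)) ^ 6 :=
        mul_le_mul_of_nonneg_right hps (pow_pos hM0 6).le

/-- **Pair quasi-locality `QL_M` + `FreeBoxSparse` ⟹ `θ(p_c) = 0` on `ℤ³`** (registered stub
`percolationContinuityZ3_of_pairQuasiLocality_of_freeBoxSparse` of line `critical-orange-peeling`,
crux stmt-CriticalPhenomena-5785; consumes the neighbouring crux stmt-CriticalPhenomena-4445).
If `θ := θ(p_c) > 0` then `P(x ↔ y) ≥ θ²` (`Grimmett1999_theta_sq_le_openConn_holds`), so by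
`QL_M` `P(x ↔ y in Λ_{Mn}) ≥ c θ²` on `Λ_n × Λ_n` and the `FreeBoxSparse` quantity at index
`M n` is `≥ c θ² / (2M)⁶ > 0` for every `n` (`div_le_pairAverage_of_boxLRO`); along
`n ↦ M n → ∞` it tends to `0` — contradiction. [folklore] -/
theorem percolationContinuityZ3_of_pairQuasiLocality_of_freeBoxSparse :
    ∀ (M : ℕ) (c : ℝ), 1 ≤ M → 0 < c →
    (∀ n : ℕ, ∀ x ∈ box 3 n, ∀ y ∈ box 3 n,
      c * (bondPercolation (zdGraph 3) (criticalProbI 3)).real (openConn x y) ≤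
        (bondPercolation (zdGraph 3) (criticalProbI 3)).real
          (openConnIn (↑(box 3 (M * n)) : Set (Site 3)) x y)) →
    Summit.CriticalPhenomena.PercolationContinuityZ3.Theses.PercNonProliferation.FreeBoxSparse →
    _root_.PercolationContinuityZ3 := by
  intro M c hM hc hQL hF
  unfold Summit.CriticalPhenomena.PercolationContinuityZ3.Theses.PercNonProliferation.FreeBoxSparse
    at hF
  show theta (zdGraph 3) (0 : Site 3) (criticalProbI 3) = 0
  by_contra hne
  have hθ : 0 < theta (zdGraph 3) (0 : Site 3) (criticalProbI 3) :=
    lt_of_le_of_ne measureReal_nonneg (Ne.symm hne)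
  set θ := theta (zdGraph 3) (0 : Site 3) (criticalProbI 3) with hθdef
  have hM0 : (0 : ℝ) < 2 * (M : ℝ) := by
    have hM1 : (1 : ℝ) ≤ M := by exact_mod_cast hM
    linarith
  have hεpos : 0 < c * θ ^ 2 / (2 * (M : ℝ)) ^ 6 := by positivity
  -- pointwise on `Λ_n × Λ_n`: `c θ² ≤ c P(x ↔ y) ≤ P(x ↔ y in Λ_{Mn})`
  have hpt : ∀ n : ℕ, ∀ x ∈ box 3 n, ∀ y ∈ box 3 n,
      c * θ ^ 2 ≤ (bondPercolation (zdGraph 3) (criticalProbI 3)).real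
        (openConnIn (↑(box 3 (M * n)) : Set (Site 3)) x y) := fun n x hx y hy =>
    (mul_le_mul_of_nonneg_left (Grimmett1999_theta_sq_le_openConn_holds 3 (criticalProbI 3) x y)
      hc.le).trans (hQL n x hx y hy)
  -- the positive floor along the subsequence `n ↦ M n`
  have hfloor : ∀ n : ℕ, c * θ ^ 2 / (2 * (M : ℝ)) ^ 6 ≤
      (∑ x ∈ box 3 (M * n), ∑ y ∈ box 3 (M * n),
          (bondPercolation (zdGraph 3) (criticalProbI 3)).real
            (openConnIn (↑(box 3 (M * n)) : Set (Site 3)) x y)) /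
        ((box 3 (M * n)).card : ℝ) ^ 2 := fun n =>
    div_le_pairAverage_of_boxLRO hM (by positivity) (hpt n)
  -- but along `n ↦ M n → ∞` the `FreeBoxSparse` quantity tends to `0`
  have hsubseq : Tendsto (fun n : ℕ => M * n) atTop atTop :=
    tendsto_atTop_mono (fun n => Nat.le_mul_of_pos_left n hM) tendsto_id
  obtain ⟨n, hn⟩ := ((hF.comp hsubseq).eventually (gt_mem_nhds hεpos)).exists
  exact absurd hn (not_lt.2 (hfloor n))

end Summit.CriticalPhenomena.PercolationContinuityZ3.Theorems.NearLinearTwoClusterDecay.Consumed
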